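import Literature.MathematicalPhysics.QuantumFieldTheory.Balaban1983to89.B9CubeLettersBondOpsL0

/-!
# `Balaban1983to89.B9CubeLettersBondOpsAtOneL0` — THE CUBE-LOCAL BOND-SECTOR LETTERS AT `U = 1`: `(Q′G′_□²Q′*)⁻¹(1)` IS THE LIFT OF THE GENUINE
# INVERSE `CinvCubeW` (a unit with NO threshold: [4] p. 235 «its inverse is well defined»), `R_□(1)`, `C_□(1)`, `Δ_{a,□}(1)` ARE THE LIFTS OF THE FLAT
# MATRICES — `Node00.OpsYDeltaA` §5 re-instantiated at the cube sequence (sub-row G-B9-LETTERS, module M5.1c PART 2 (P4), file 2)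

FRAMING (verbatim cell line):
statement-level skeleton of published theorems with citation tags; proofs where landed; nothing here is a claim about the Yang–Mills mass gap

Sources under audit (cell lit-balaban): T. Bałaban, *Propagators for lattice gauge theories in a background field*, Commun. Math. Phys. **99**
(1985) 389–434 [`Balaban1985BackgroundPropagators`, "B9"], (3.25) p. 394, (3.26)–(3.27) p. 395 («It coincides with Δ_a in (2.19) if U = 1»), (3.48) p. 398,
Cor. 3.5 p. 407, p. 409 l. 1–5; T. Bałaban, *Propagators and renormalization transformations for lattice gauge theories. II*, Commun. Math. Phys.
**96** (1984) 223–250 [`Balaban1984PropagatorsII`, "[4]"], (2.17) p. 225, (2.69), (2.86)–(2.87) pp. 235–238.  Unit `lit-balaban-r05` (r05 gen 77).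

## WHAT THIS FILE CERTIFIES (kernel-checked; `F := cubeFamY i q`, `G′_□(1) = gpWc i q := GpCubeW …`, weights `wCube`)

* `toMatrix_XkT_cube` — the matrix of T8's `Q′G′²Q′*` operator `kerOp (W F) (XkT F wCube)` is `qpKc·G′_□(1)·G′_□(1)·qpsKc`;
* `isUnit_BmT_cube` — its conjugated kernel is a unit (NO threshold: `B6Prop23MultiLevelTorusL0.isUnit_BmT`, weights in `(0, 1]`);
* `xK_mul_xinvKc` — `(qpKc·G′_□²·qpsKc)·xinvKc = 1` with `xinvKc := toMatrix' (CinvCubeW …)`;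
* ★ `XinvCubeY_one` — `(Q′G′_□²Q′*)⁻¹(1) = xinvKc♯` (the `Ring.inverse` IS the genuine inverse at `U = 1`); ★ `RCubeY_one` — `R_□(1) = rKc♯`,
  `rKc := 1 − G′_□(1)·qpsKc·xinvKc·qpKc·G′_□(1)`; ★ `CCubeY_one` — `C_□(1) = (xinvKc·diag cWtCubeY)♯`; ★ `deltaACubeY_one` —
  `Δ_{a,□}(1) = (cocurlK·curlK + gradK·rKc·divK + qsKc·aKc·qKc)♯`, `isUnit`-free statements.

## HONEST SCOPE

* The remaining identification `(cocurlK·curlK + gradK·rKc·divK + qsKc·aKc·qKc) = toMatrix' (onFun (deltaAE (domCube i q) …))` (r03's typed `Δ_a` of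
  the cube sequence, via the chart identity `RE_eq_rM_chart` at `F`) — after which `B9Thm33CubeAtOne` applies to `GACubeY … 1` — is NOT in this file.
* Nothing is inferred from the manuscript; kernel-checked.  NOT summit progress; the YM mass gap is not proved by any of this.
-/

namespace Literature.MathematicalPhysics.QuantumFieldTheory.Balaban1983to89.B9CubeLettersBondOpsAtOneL0

open LatticeFieldCalculus
open Node00
open Literature.MathematicalPhysics.QuantumFieldTheory.Balaban1983to89.B6KLevelCensusIndexV1 (KIdx)
open Literature.MathematicalPhysics.QuantumFieldTheory.Balaban1983to89.B6Cover236MultiLevelBlocks (cubes)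
open Literature.MathematicalPhysics.QuantumFieldTheory.Balaban1983to89.B6Ineq268MultiLevelBoxL0 (W)
open Literature.MathematicalPhysics.QuantumFieldTheory.Balaban1983to89.B6Expansion282 (kerOp)
open Literature.MathematicalPhysics.QuantumFieldTheory.Balaban1983to89.B8Ineq192MultiLevelTorusL0 (XkT kerOp_XkT)
open Literature.MathematicalPhysics.QuantumFieldTheory.Balaban1983to89.B6Prop23MultiLevelTorusL0 (GinvT BmT isUnit_BmT X_mul_GinvT)
open Literature.MathematicalPhysics.QuantumFieldTheory.Balaban1983to89.B6Ineq288MultiLevelTorusL0 (toMatrix_QB toMatrix_QsB)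
open Literature.MathematicalPhysics.QuantumFieldTheory.Balaban1983to89.B9CubeLettersOpsL0 (cubeFamY GpCubeY GpCubeY_one oddMh)
open Literature.MathematicalPhysics.QuantumFieldTheory.Balaban1983to89.B9Thm31CubeLocalFlat (wCube wCube_pos wCube_window GpCubeW CinvCubeW)
open Literature.MathematicalPhysics.QuantumFieldTheory.Balaban1983to89.B9Cor35AtOneInverseLetters (one_le_ell)
open Literature.MathematicalPhysics.QuantumFieldTheory.Balaban1983to89.B9CubeLettersBondOpsL0
open scoped Matrix

noncomputable section

variable {d ℓ : ℕ} {hd : 1 ≤ d + 1} {hL : Odd (ℓ + 1) ∧ 1 < ℓ + 1} {b₀ b₁ : ℝ}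
variable {𝔸 : Type} [NormedRing 𝔸] [NormedAlgebra ℂ 𝔸] [CompleteSpace 𝔸]
variable (i : KIdx d ℓ hd hL b₀ b₁) (q : ↥(cubes (toKT i).D.toDomains))

/-- the flat `G′_□(1) = GpCubeW` at the index. [cite: Balaban1985BackgroundPropagators, Cor. 3.5 p.407, p.409, dictionary] -/
abbrev gpWc : Matrix (SiteY i) (SiteY i) ℝ := GpCubeW (toKT i).D q hL.1 (oddMh i) (toKT i).hMh (toKT i).hP

/-- the matrix of the genuine inverse `(Q′G′_□²Q′*)⁻¹ = CinvCubeW`. [cite: Balaban1985BackgroundPropagators, (3.25) p.394; Balaban1984PropagatorsII, (2.17) p.225] -/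
def xinvKc : Matrix (BlkCubeY i q) (BlkCubeY i q) ℝ := LinearMap.toMatrix' (CinvCubeW (toKT i).D q hL.1 (oddMh i) (toKT i).hMh (toKT i).hP)

/-- the flat `R_□(1) = 1 − G′_□Q′*(Q′G′_□²Q′*)⁻¹Q′G′_□`. [cite: Balaban1985BackgroundPropagators, (3.25) p.394] -/
def rKc : Matrix (SiteY i) (SiteY i) ℝ := 1 - gpWc i q * qpsKc i q * xinvKc i q * qpKc i q * gpWc i q

/-- the matrix of T8's `Q′G′_□²Q′*` operator of the cube sequence is the flat product. [cite: Balaban1984PropagatorsII, (2.17) p.225, (2.69) p.235, bookkeeping] -/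
theorem toMatrix_XkT_cube :
    LinearMap.toMatrix' (kerOp (W (cubeFamY i q).toDomains) (XkT (cubeFamY i q) (wCube ℓ))) = qpKc i q * gpWc i q * gpWc i q * qpsKc i q := by
  rw [kerOp_XkT, LinearMap.toMatrix'_comp, LinearMap.toMatrix'_comp, LinearMap.toMatrix'_comp, LinearMap.toMatrix'_toLin', toMatrix_QB,
    toMatrix_QsB]
  simp only [Matrix.mul_assoc]
  rfl

/-- the conjugated kernel of `Q′G′_□²Q′*` is a unit — NO threshold (weights `wCube ∈ (0, 1]`). [cite: Balaban1984PropagatorsII, p.235 («its inverse is well defined»), Prop. 2.3 p.238] -/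
theorem isUnit_BmT_cube : IsUnit (BmT (cubeFamY i q) (wCube ℓ)) :=
  isUnit_BmT (cubeFamY i q) (wCube ℓ) (one_le_ell i) (toKT i).hMh (toKT i).hP (wCube_pos (one_le_ell i))
    (fun j => (wCube_window (one_le_ell i) j).2)

/-- `(Q′G′_□²Q′*)·(Q′G′_□²Q′*)⁻¹ = 1` as matrices. [cite: Balaban1984PropagatorsII, (2.17) p.225, p.235] -/
theorem xK_mul_xinvKc : qpKc i q * gpWc i q * gpWc i q * qpsKc i q * xinvKc i q = 1 := by
  have hX : kerOp (W (cubeFamY i q).toDomains) (XkT (cubeFamY i q) (wCube ℓ)) * GinvT (cubeFamY i q) (wCube ℓ) = 1 :=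
    X_mul_GinvT (cubeFamY i q) (wCube ℓ) (isUnit_BmT_cube i q)
  have hmat := congrArg LinearMap.toMatrix' hX
  rw [LinearMap.toMatrix'_mul, LinearMap.toMatrix'_one, toMatrix_XkT_cube] at hmat
  exact hmat

/-- ★ **`(Q′G′_□²Q′*)⁻¹(1)` IS THE LIFT OF THE GENUINE INVERSE `CinvCubeW`** (the `Ring.inverse` is the genuine inverse at `U = 1`).
[cite: Balaban1985BackgroundPropagators, (3.25) p.394, Cor. 3.5 p.407, p.409; Balaban1984PropagatorsII, (2.86)–(2.87) p.238] -/
theorem XinvCubeY_one {parS : SiteParY 𝔸 i} (hparS : ∀ z w, parS (fun _ _ => 1) z w = 1) :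
    XinvCubeY i q parS (fun _ _ => 1) = liftOpY 𝔸 (xinvKc i q) :=
  B9Cor35AtOneInverseLetters.eq_liftOpY_of_ringInverse rfl (xK_mul_xinvKc i q) fun f E => by
    rw [XCubeY_one i q hparS, liftMatY_liftY]

/-- ★ **`R_□(1)` IS THE LIFT OF `rKc`**. [cite: Balaban1985BackgroundPropagators, (3.25) p.394, Cor. 3.5 p.407] -/
theorem RCubeY_one {parS : SiteParY 𝔸 i} (hparS : ∀ z w, parS (fun _ _ => 1) z w = 1) :
    RCubeY i q parS (fun _ _ => 1) = liftMatY 𝔸 (rKc i q) := by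
  rw [RCubeY, XinvCubeY_one i q hparS, QpCubeY_one i q hparS, QpsCubeY_one i q hparS, GpCubeY_one i q parS hparS, liftOpY_eq_liftMatY,
    liftOpY_eq_liftMatY, ← liftMatY_mul, ← liftMatY_mul, ← liftMatY_mul, ← liftMatY_mul, ← liftMatY_one 𝔸, ← liftMatY_sub, rKc]
  simp only [Matrix.mul_assoc]

/-- ★ **`C_□(1)` IS THE LIFT OF `xinvKc·diag(cWtCubeY)`** (the (3.48)-kernel of the cube sequence in print's units).
[cite: Balaban1985BackgroundPropagators, (3.48) p.398, Cor. 3.5 p.407, p.409] -/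
theorem CCubeY_one {parS : SiteParY 𝔸 i} (hparS : ∀ z w, parS (fun _ _ => 1) z w = 1) :
    CCubeY i q parS (fun _ _ => 1) = liftMatY 𝔸 (xinvKc i q * Matrix.diagonal (cWtCubeY i q)) := by
  rw [CCubeY, XinvCubeY_one i q hparS, liftOpY_eq_liftMatY, ← liftMatY_mul]

/-- ★ **`Δ_{a,□}(1)` IS THE LIFT OF THE FLAT MATRIX `∂*∂ + ∂ rKc ∂* + Q*aQ` of the cube sequence**.
[cite: Balaban1985BackgroundPropagators, (3.26) p.395 («It coincides with Δ_a in (2.19) if U = 1»), p.409] -/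
theorem deltaACubeY_one {parS : SiteParY 𝔸 i} {parB : BondParY 𝔸 i} (hparS : ∀ z w, parS (fun _ _ => 1) z w = 1)
    (hparB : ∀ s s', parB (fun _ _ => 1) s s' = 1) :
    deltaACubeY i q parS parB (fun _ _ => 1) =
      liftMatY 𝔸 (cocurlK i * curlK i + gradK i * rKc i q * divK i + qsKc i q * aKc i q * qKc i q) := by
  rw [deltaACubeY, hessY_one, gradY_one, divY_one, RCubeY_one i q hparS, QsCubeY_one i q hparB, QCubeY_one i q hparB, aCubeY,
    ← liftMatY_mul, ← liftMatY_mul, ← liftMatY_mul, ← liftMatY_mul, ← liftMatY_mul, ← liftMatY_add, ← liftMatY_add]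
  simp only [Matrix.mul_assoc]

/-- `G_□(1) = Ring.inverse` of that lift. [cite: Balaban1985BackgroundPropagators, (3.27) p.395, p.409] -/
theorem GACubeY_one_eq {parS : SiteParY 𝔸 i} {parB : BondParY 𝔸 i} (hparS : ∀ z w, parS (fun _ _ => 1) z w = 1)
    (hparB : ∀ s s', parB (fun _ _ => 1) s s' = 1) :
    GACubeY i q parS parB (fun _ _ => 1) =
      Ring.inverse (liftMatY 𝔸 (cocurlK i * curlK i + gradK i * rKc i q * divK i + qsKc i q * aKc i q * qKc i q)) := by
  rw [GACubeY, deltaACubeY_one i q hparS hparB]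

end

end Literature.MathematicalPhysics.QuantumFieldTheory.Balaban1983to89.B9CubeLettersBondOpsAtOneL0
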